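import Summits.QuantumFields.YangMills.Theorems.LuscherReductionTwistedTraceScalingStiffHessian
import Summits.QuantumFields.YangMills.Theorems.LuscherReductionTwistedTraceScalingElectricSplit
import HarnessLib

/-!
# Zero modes vs stiff modes in `LinkSpace L`: the direction means (Lüscher's nine constant modes) and the exact Pythagoras split
# `‖v − v'‖² = |sites|·Σ_k |m_k(v) − m_k(v')|² + Σ_e |f_e(v) − f_e(v')|²` of the kinetic exponent of the harmonic model
# (lane B of S-BASE, crux `TwistedTraceScaling` stmt-QuantumFields-20203; both COARSE lanes)

Colour-vector twin of `…ElectricSplit` (which splits the Frobenius-linear kinetic exponent): in the coordinates `v ∈ LinkSpace L` of the harmonic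
model (`…StiffHessian`, `…KineticChart`) the kinetic Gaussian `e^{−b‖v−v'‖²}` factorises EXACTLY into the Gaussian of the direction means
`m_k(v) = |sites|⁻¹ Σ_x v(x,k;·) ∈ ℝ³` (the zero modes of the curl, `latCurl_constMode`) at the one-site kinetic constant `b·|sites| = b·L³`, and
the Gaussian of the fluctuations `f_{(x,k)}(v) = v(x,k;·) − m_k(v)`: `dirMean`, `dirFluc`, `sum_dirFluc_eq_zero`, ★ `norm_sub_sq_eq_mean_add_fluc`.
HONEST FRAMING: finite-dimensional algebra; femto rung R2b1 (stub of a child of a CONDITIONAL route); not a gap, not Clay.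
-/

set_option autoImplicit false

noncomputable section

open scoped BigOperators RealInnerProductSpace
open Literature.MathematicalPhysics.QuantumFieldTheory
open Literature.MathematicalPhysics.QuantumLattice

namespace Summit.QuantumFields.YangMills.Theorems.FemtoTransferGap.TwoLattice.Stiff

open Summit.QuantumFields.YangMills.Theorems.FemtoTransferGap.TwoLattice

variable {L : ℕ} [NeZero L]

/-- The colour vector of `v` on the link `e`, as an element of `ℝ³ = EuclideanSpace ℝ (Fin 3)`. [folklore] -/
def linkCol (v : LinkSpace L) (e : Edge 3 L) : EuclideanSpace ℝ (Fin 3) := WithLp.toLp 2 fun a => v (e, a)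

/-- **Direction mean** (zero-mode coordinate) `m_k(v) = |sites|⁻¹ Σ_x v(x,k;·) ∈ ℝ³`. [cite: Luscher1983, §3] -/
def dirMean (k : Fin 3) (v : LinkSpace L) : EuclideanSpace ℝ (Fin 3) :=
  (Fintype.card (Site 3 L) : ℝ)⁻¹ • ∑ x : Site 3 L, linkCol v (x, k)

/-- **Fluctuation** (stiff coordinate) `f_{(x,k)}(v) = v(x,k;·) − m_k(v)`. [cite: Luscher1983, §3] -/
def dirFluc (e : Edge 3 L) (v : LinkSpace L) : EuclideanSpace ℝ (Fin 3) := linkCol v e - dirMean e.2 v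

omit [NeZero L] in
/-- Components of `linkCol`. [folklore] -/
@[simp] theorem linkCol_apply (v : LinkSpace L) (e : Edge 3 L) (a : Fin 3) : linkCol v e a = v (e, a) := rfl

omit [NeZero L] in
/-- `linkCol` is additive/subtractive in `v`. [folklore] -/
theorem linkCol_sub (v w : LinkSpace L) (e : Edge 3 L) : linkCol (v - w) e = linkCol v e - linkCol w e := by
  ext a; simp [linkCol]

/-- `m_k(v − w) = m_k(v) − m_k(w)`. [folklore] -/
theorem dirMean_sub (k : Fin 3) (v w : LinkSpace L) : dirMean k (v - w) = dirMean k v - dirMean k w := by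
  unfold dirMean
  simp only [linkCol_sub, Finset.sum_sub_distrib, smul_sub]

/-- `f_e(v − w) = f_e(v) − f_e(w)`. [folklore] -/
theorem dirFluc_sub (e : Edge 3 L) (v w : LinkSpace L) : dirFluc e (v - w) = dirFluc e v - dirFluc e w := by
  unfold dirFluc; rw [linkCol_sub, dirMean_sub]; abel

/-- The fluctuations have zero mean in every direction: `Σ_x f_{(x,k)}(v) = 0`. [folklore] -/
theorem sum_dirFluc_eq_zero (k : Fin 3) (v : LinkSpace L) : ∑ x : Site 3 L, dirFluc (x, k) v = 0 := by
  have h : ∀ x : Site 3 L, dirFluc (x, k) v = linkCol v (x, k) - dirMean k v := fun x => rfl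
  simp only [h, Finset.sum_sub_distrib, Finset.sum_const, Finset.card_univ]
  unfold dirMean
  rw [← Nat.cast_smul_eq_nsmul ℝ, smul_smul,
    mul_inv_cancel₀ (by exact_mod_cast Fintype.card_ne_zero : (Fintype.card (Site 3 L) : ℝ) ≠ 0), one_smul, sub_self]

/-- `‖v‖² = Σ_e |v(e;·)|²` (links × colours). [folklore] -/
theorem norm_sq_eq_sum_linkCol (v : LinkSpace L) : ‖v‖ ^ 2 = ∑ e : Edge 3 L, ‖linkCol v e‖ ^ 2 := by
  rw [EuclideanSpace.norm_sq_eq, Fintype.sum_prod_type]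
  refine Finset.sum_congr rfl fun e _ => ?_
  rw [EuclideanSpace.norm_sq_eq]
  rfl

/-- ★ **Exact zero-mode / stiff split of the kinetic exponent of the harmonic model**:
`‖v − w‖² = |sites|·Σ_k |m_k(v) − m_k(w)|² + Σ_e |f_e(v) − f_e(w)|²` — the Gaussian `e^{−b‖v−w‖²}` is the product of the zero-mode Gaussian
at kinetic constant `b·|sites|` (the one-site constant at coupling `L³β`) and the fluctuation Gaussian. [cite: Luscher1983, §3] -/
theorem norm_sub_sq_eq_mean_add_fluc (v w : LinkSpace L) :
    ‖v - w‖ ^ 2 = (Fintype.card (Site 3 L) : ℝ) * ∑ k : Fin 3, ‖dirMean k v - dirMean k w‖ ^ 2 +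
      ∑ e : Edge 3 L, ‖dirFluc e v - dirFluc e w‖ ^ 2 := by
  rw [norm_sq_eq_sum_linkCol, Fintype.sum_prod_type, Finset.sum_comm, Finset.mul_sum]
  rw [show ∑ e : Edge 3 L, ‖dirFluc e v - dirFluc e w‖ ^ 2 = ∑ k : Fin 3, ∑ x : Site 3 L, ‖dirFluc (x, k) v - dirFluc (x, k) w‖ ^ 2 by
    rw [Fintype.sum_prod_type, Finset.sum_comm]]
  rw [← Finset.sum_add_distrib]
  refine Finset.sum_congr rfl fun k _ => ?_
  -- Pythagoras for the family `x ↦ (v − w)(x,k;·)` in `ℝ³`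
  have h := Electric.sum_norm_sq_eq_card_mul_mean_add (ι := Site 3 L) (E := EuclideanSpace ℝ (Fin 3)) fun x => linkCol (v - w) (x, k)
  have hm : (Fintype.card (Site 3 L) : ℝ)⁻¹ • ∑ x, (linkCol v (x, k) - linkCol w (x, k)) = dirMean k v - dirMean k w := by
    unfold dirMean; rw [Finset.sum_sub_distrib, smul_sub]
  simp only [linkCol_sub] at h
  rw [hm] at h
  have hf : ∀ x : Site 3 L, linkCol v (x, k) - linkCol w (x, k) - (dirMean k v - dirMean k w) = dirFluc (x, k) v - dirFluc (x, k) w := by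
    intro x; unfold dirFluc; abel
  simp only [hf] at h
  exact h

/-- The direction-constant lift of the means is a zero mode of the curl (so the zero-mode Gaussian carries exactly Lüscher's nine modes).
[cite: Luscher1983, §3] -/
theorem latCurl_meanLift (v : LinkSpace L) :
    latCurl L (WithLp.toLp 2 fun ea : Edge 3 L × Fin 3 => dirMean ea.1.2 v ea.2) = 0 :=
  latCurl_constMode L fun k a => dirMean k v a

end Summit.QuantumFields.YangMills.Theorems.FemtoTransferGap.TwoLattice.Stiff

end
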